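import Summits.Parity.GeneralizedHardyLittlewood.Theorems.LiouvilleShiftedTablesTypeI2DilatedURB5
import Literature.NumberTheory.Sieve.BombieriFriedlanderIwaniecCombinatorics

/-!
# The `𝔲_R` terms of the assembly (`stub_uRBound`), file 10: classification of the box pieces

Route `LiouvilleShiftedTables` (Parity / GeneralizedHardyLittlewood), crux `TypeI2Dilated` (stmt-Parity-14272), line
`peel-to-drappeau`, registered stub `stub_uRBound : URBound`; continuation of `…URB1`–`…URB5` (Types 0 and II).

**Every box piece has `NS(F_{j,κ}) ≤ x^{1−6ρ}`** (`urb_box`, Steps C/0/II/I of the stub's proof).  With `V_i` the scales,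
`P₀ = ∏ V_i`, `v_i = log_x V_i`: (a) `Y ≤ P₀`: `F` vanishes on `[1, Y]` and `NS = 0`; (b) `P₀ ≤ x^{1−ρ₀'}`: Type 0
(`urb_type0`); (c) otherwise the partial-sum dichotomy `BFI.exists_subsum_mem_Icc_or` (`a = 1/50`, `b = 1/3 − 1/50`) gives
either a set `S` of slots with `x^{1/50} ≤ ∏_S V_i ≤ x^{1/3−1/50}` — Type II (`urb_typeII`) — or the set `T` of slots with
`v_i ≥ 1/50` has all `v_i > 1/3 − 1/50` while `∏_{i∉T} V_i < x^{1/50}`; a large slot that is not a `ζ`-slot kills the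
piece (`hbSlot_eq_zero_of_large`: the factors `1_{□,≤K}`, `μ_{≤U}` vanish above `K ≤ x^{120ρ}`, `U ≤ (2x)^{1/4}`, both
`< x^{1/3−1/50}`), otherwise `1 ≤ #T ≤ j − 1 ≤ 3` and Type I applies (the conclusion of `urb_typeI` of file `…URB9`, taken
here as the hypothesis `hI` of `urb_box`; the final file combines the two).
[this line: Lines/peel-to-drappeau.md; cite: Drappeau2017, §6]
-/

noncomputable section

namespace Summit.Parity.GeneralizedHardyLittlewood.Cruxes.TypeI2Dilated.PeelToDrappeau

open Finset Fintype Real Filter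
open scoped ArithmeticFunction.sigma Classical
open Literature.NumberTheory.Sieve Literature.NumberTheory.Sieve.Drappeau2017

/-! ### Large non-`ζ` slots kill the piece -/

/-- `K = ⌊x^{60ρ}⌋² ≤ x^{120ρ}`. [this line] -/
theorem urbK_le {x : ℝ} (hx : 0 ≤ x) (ρ : ℝ) : (urbK x ρ : ℝ) ≤ x ^ (120 * ρ) := by
  unfold urbK
  have h0 : 0 ≤ x ^ (60 * ρ) := Real.rpow_nonneg hx _
  have h1 : (⌊x ^ (60 * ρ)⌋₊ : ℝ) ≤ x ^ (60 * ρ) := Nat.floor_le h0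
  push_cast
  calc (⌊x ^ (60 * ρ)⌋₊ : ℝ) ^ 2 ≤ (x ^ (60 * ρ)) ^ 2 := pow_le_pow_left₀ (Nat.cast_nonneg _) h1 2
    _ = x ^ (120 * ρ) := by rw [← Real.rpow_natCast (x ^ (60 * ρ)) 2, ← Real.rpow_mul hx]; ring_nf

/-- `U = ⌊(2x)^{1/4}⌋ ≤ (2x)^{1/4}`. [this line] -/
theorem urbU_le {x : ℝ} (hx : 0 ≤ x) : (urbU x : ℝ) ≤ (2 * x) ^ (1 / 4 : ℝ) :=
  Nat.floor_le (Real.rpow_nonneg (by linarith) _)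

/-- **A large slot that is not a `ζ`-slot is identically zero**: if `i ≤ j` and `K, U ≤ V_i`, then `slot_i = 0`. [this line] -/
theorem hbSlot_eq_zero_of_large {x : ℝ} (hx : 0 < x) (ρ : ℝ) {j : ℕ} (κ : Fin (2 * j) → ℕ) {i : Fin (2 * j)}
    (hij : (i : ℕ) ≤ j) (hK : (urbK x ρ : ℝ) ≤ boxScale x (κ i)) (hU : (urbU x : ℝ) ≤ boxScale x (κ i)) :
    hbSlot x ρ j κ i = 0 := by
  ext n
  rw [ArithmeticFunction.zero_apply]
  by_contra hne
  obtain ⟨hmem, hF⟩ := hbSlot_ne_zero hx hne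
  have hnV := ((BFI.mem_dyadic (boxScale_pos hx _).le).1 hmem).1
  rcases Nat.eq_zero_or_pos (i : ℕ) with h0 | hpos
  · have hKn : urbK x ρ < n := by exact_mod_cast hK.trans_lt hnV
    have : HeathBrownLiouville.hbFactor (urbK x ρ) (urbU x) j i n = 0 := by
      rw [h0]; exact HeathBrownLiouville.hbFactor_zero_eq_zero hKn
    exact hF this
  · have hUn : urbU x < n := by exact_mod_cast hU.trans_lt hnV
    exact hF (HeathBrownLiouville.hbFactor_moebius_eq_zero hpos hij hUn)

/-- If some slot vanishes identically, so does the piece, and `NS = 0`. [this line] -/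
theorem normSum_hbBox_eq_zero_of_slot {x ρ : ℝ} {j : ℕ} {κ : Fin (2 * j) → ℕ} {i : Fin (2 * j)}
    (h : hbSlot x ρ j κ i = 0) (c : ℤ) (w P : ℕ) (Y R Slo : ℝ) :
    normSum c w P x ρ Y R Slo (fun m => hbBox x ρ j κ m) = 0 := by
  have hF : hbBox x ρ j κ = 0 := Finset.prod_eq_zero (Finset.mem_univ i) h
  exact normSum_eq_zero_of c w P x ρ Y R Slo fun m _ => by rw [hF, ArithmeticFunction.zero_apply]

/-! ### Scales as powers of `x` -/

/-- `∏_{i ∈ S} V_i = x^{∑_{i ∈ S} log_x V_i}` (`x > 1`). [folklore] -/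
theorem prod_boxScale_eq_rpow {x : ℝ} (hx : 1 < x) {j : ℕ} (κ : Fin (2 * j) → ℕ) (S : Finset (Fin (2 * j))) :
    ∏ i ∈ S, boxScale x (κ i) = x ^ (∑ i ∈ S, Real.logb x (boxScale x (κ i))) := by
  rw [Real.rpow_sum_of_pos (by linarith)]
  exact Finset.prod_congr rfl fun i _ => (Real.rpow_logb (by linarith) hx.ne' (boxScale_pos (by linarith) _)).symm

/-- The number of `ζ`-slots containing `T` bounds `#T`: if every `i ∈ T` has `j < i`, then `#T ≤ j − 1`. [folklore] -/
theorem card_le_of_zeta_slots {j : ℕ} {T : Finset (Fin (2 * j))} (hT : ∀ i ∈ T, j < (i : ℕ)) : T.card ≤ j - 1 := by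
  have h := Finset.card_le_card_of_injOn (s := T) (t := Finset.Ioc j (2 * j - 1)) Fin.val
    (fun i hi => by
      have := hT i hi
      have := i.isLt
      simp only [Finset.coe_Ioc, Set.mem_Ioc]
      omega)
    (Fin.val_injective.injOn)
  rw [Nat.card_Ioc] at h
  omega

/-! ### Every box -/

/-- **Steps C, 0, II, I — every box piece has `NS(F_{j,κ}) ≤ x^{1−6ρ}`** (see the module docstring); the Type I
estimate (the conclusion of `urb_typeI` of file 9, which needs `DilatedDivisorAP`) is taken as the hypothesis `hI`, so that
this file does not wait for the Type I files. [this line; cite: Drappeau2017, §6] -/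
theorem urb_box (hDT : DilatedTypeII) {c : ℤ} (hc : c ≠ 0)
    (hI : ∃ ρ₃ : ℝ, 0 < ρ₃ ∧ ∀ ρ : ℝ, 0 < ρ → ρ ≤ ρ₃ → ∃ x₀ : ℝ, ∀ x : ℝ, x₀ ≤ x →
      ∀ w : ℕ, ∀ Y R Slo : ℝ, ∀ P : ℕ, 1 ≤ P → 0 ≤ Y → Y ≤ 2 * x → 1 ≤ R → (P : ℝ) * R ≤ x ^ (4 * ρ) →
        0 ≤ Slo → 2 * Slo * R * P ≤ x ^ (1 / 2 + ρ) →
      ∀ j ∈ Icc 1 4, ∀ κ : Fin (2 * j) → ℕ, ∀ T : Finset (Fin (2 * j)), 1 ≤ T.card → T.card ≤ 3 →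
        (∀ i ∈ T, j < (i : ℕ)) → (∀ i ∈ T, x ^ (1 / 3 - 1 / 50 : ℝ) < boxScale x (κ i)) →
        (∏ i ∈ Tᶜ, boxScale x (κ i)) ≤ x ^ (1 / 50 : ℝ) →
        normSum c w P x ρ Y R Slo (fun m => hbBox x ρ j κ m) ≤ x ^ (1 - 6 * ρ)) :
    ∃ ρ₁ : ℝ, 0 < ρ₁ ∧ ρ₁ ≤ 1 / 100 ∧ ∀ ρ : ℝ, 0 < ρ → ρ ≤ ρ₁ → ∃ x₀ : ℝ, ∀ x : ℝ, x₀ ≤ x →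
      ∀ w : ℕ, ∀ Y R Slo : ℝ, ∀ P : ℕ, 1 ≤ P → 0 ≤ Y → Y ≤ 2 * x → 1 ≤ R → (P : ℝ) * R ≤ x ^ (4 * ρ) →
        x ^ (1 / 2 - 9 * ρ) ≤ Slo → 2 * Slo * R * P ≤ x ^ (1 / 2 + ρ) →
        ∀ j ∈ Icc 1 4, ∀ κ : Fin (2 * j) → ℕ,
          normSum c w P x ρ Y R Slo (fun m => hbBox x ρ j κ m) ≤ x ^ (1 - 6 * ρ) := by
  obtain ⟨ρ₀, hρ₀, hρ₀1, hII⟩ := urb_typeII hDT hc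
  obtain ⟨ρ₃, hρ₃, hI⟩ := hI
  refine ⟨min (ρ₀ / 60) ρ₃, lt_min (by linarith) hρ₃, (min_le_left _ _).trans (by linarith), fun ρ hρ hρle => ?_⟩
  have h60 : 60 * ρ ≤ ρ₀ := by have := hρle.trans (min_le_left _ _); linarith
  have hρ3 : ρ ≤ ρ₃ := hρle.trans (min_le_right _ _)
  have hρ100 : ρ ≤ 1 / 100 := by linarith
  obtain ⟨xII, hxII⟩ := hII ρ hρ h60
  obtain ⟨xI, hxI⟩ := hI ρ hρ hρ3
  obtain ⟨x0, hx0T⟩ := urb_type0 c hρ hρ100 h60 (by linarith)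
  have hev : ∀ᶠ x : ℝ in atTop, (2 : ℝ) ^ (1 / 4 : ℝ) ≤ x ^ (19 / 300 : ℝ) ∧ (2 : ℝ) ≤ x :=
    (eventually_le_rpow _ (by norm_num)).and (eventually_ge_atTop _)
  obtain ⟨x₁, hx₁⟩ := Filter.eventually_atTop.1 hev
  refine ⟨max (max xII xI) (max x0 x₁), fun x hx w Y R Slo P hP hY0 hY hR hPR hSlo hSRP j hj κ => ?_⟩
  have hxII' : xII ≤ x := le_trans ((le_max_left _ _).trans (le_max_left _ _)) hx
  have hxI' : xI ≤ x := le_trans ((le_max_right _ _).trans (le_max_left _ _)) hx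
  have hx0' : x0 ≤ x := le_trans ((le_max_left _ _).trans (le_max_right _ _)) hx
  obtain ⟨e1, e2⟩ := hx₁ x (le_trans ((le_max_right _ _).trans (le_max_right _ _)) hx)
  have hx1 : 1 < x := by linarith
  have hx0 : 0 < x := by linarith
  have hxpos : ∀ a : ℝ, 0 < x ^ a := fun a => Real.rpow_pos_of_pos hx0 a
  have hSlo0 : 0 ≤ Slo := (hxpos _).le.trans hSlo
  have hjmem := hj
  rw [Finset.mem_Icc] at hj
  -- the scales
  set V : Fin (2 * j) → ℝ := fun i => boxScale x (κ i) with hV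
  set v : Fin (2 * j) → ℝ := fun i => Real.logb x (boxScale x (κ i)) with hv
  have hV0 : ∀ i, 0 < V i := fun i => boxScale_pos hx0 _
  have hVv : ∀ S : Finset (Fin (2 * j)), ∏ i ∈ S, V i = x ^ (∑ i ∈ S, v i) := fun S => prod_boxScale_eq_rpow hx1 κ S
  have hVi : ∀ i, V i = x ^ (v i) := fun i => by simpa using hVv {i}
  -- (a) `Y ≤ ∏ V`: the piece vanishes on `[1, Y]`
  by_cases hA : Y ≤ ∏ i, V i
  · rw [normSum_eq_zero_of c w P x ρ Y R Slo fun m hm => ?_]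
    · exact (hxpos _).le
    · by_contra hne
      have h1 := (hbBox_ne_zero_bounds hx0 ρ hj.1 κ hne).1
      rw [Finset.mem_Icc] at hm
      have h2 : (m : ℝ) ≤ Y := le_trans (by exact_mod_cast hm.2) (Nat.floor_le hY0)
      exact absurd (hA.trans_lt h1) (not_lt.2 h2)
  push Not at hA
  have hP2x : ∏ i, V i ≤ 2 * x := by linarith
  -- (b) Type 0
  by_cases hB : ∏ i, V i ≤ x ^ (1 - ρ₀)
  · exact hx0T x hx0' w Y R Slo P hP hY hR hPR hSlo0 hSRP j hjmem κ hB
  push Not at hB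
  -- (c) the dichotomy
  rcases BFI.exists_subsum_mem_Icc_or v (a := 1 / 50) (b := 1 / 3 - 1 / 50) (by norm_num) (by norm_num) with
    ⟨S, hS1, hS2⟩ | ⟨hsmall, hbig⟩
  · -- Type II
    refine hxII x hxII' w Y R Slo P hP hY hR hPR hSlo hSRP j hjmem κ S hB.le hP2x ?_ ?_
    · rw [hVv]; exact Real.rpow_le_rpow_of_exponent_le hx1.le hS1
    · rw [hVv]; exact Real.rpow_le_rpow_of_exponent_le hx1.le hS2
  · -- Type I
    set T : Finset (Fin (2 * j)) := Finset.univ.filter (fun i => (1 / 50 : ℝ) ≤ v i) with hT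
    have hTc : Tᶜ = Finset.univ.filter (fun i => v i < 1 / 50) := by
      rw [hT, Finset.compl_filter]
      exact Finset.filter_congr fun i _ => not_le
    have hTbig : ∀ i ∈ T, x ^ (1 / 3 - 1 / 50 : ℝ) < V i := by
      intro i hi
      rw [hT, Finset.mem_filter] at hi
      rw [hVi]
      exact (Real.rpow_lt_rpow_left_iff hx1).2 (hbig i hi.2)
    have hTsm : ∏ i ∈ Tᶜ, V i ≤ x ^ (1 / 50 : ℝ) := by
      rw [hVv, hTc]
      exact Real.rpow_le_rpow_of_exponent_le hx1.le hsmall.le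
    -- a large slot that is not a `ζ`-slot kills the piece
    by_cases hζ : ∀ i ∈ T, j < (i : ℕ)
    swap
    · push Not at hζ
      obtain ⟨i, hiT, hij⟩ := hζ
      have hVlarge : x ^ (1 / 3 - 1 / 50 : ℝ) < V i := hTbig i hiT
      have hK : (urbK x ρ : ℝ) ≤ V i := by
        refine ((urbK_le hx0.le ρ).trans (Real.rpow_le_rpow_of_exponent_le hx1.le ?_)).trans hVlarge.le
        linarith
      have hU : (urbU x : ℝ) ≤ V i := by
        refine le_trans ?_ hVlarge.le
        calc (urbU x : ℝ) ≤ (2 * x) ^ (1 / 4 : ℝ) := urbU_le hx0.le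
          _ = 2 ^ (1 / 4 : ℝ) * x ^ (1 / 4 : ℝ) := Real.mul_rpow (by norm_num) hx0.le
          _ ≤ x ^ (19 / 300 : ℝ) * x ^ (1 / 4 : ℝ) := mul_le_mul_of_nonneg_right e1 (hxpos _).le
          _ = x ^ (1 / 3 - 1 / 50 : ℝ) := by rw [← Real.rpow_add hx0]; norm_num
      rw [normSum_hbBox_eq_zero_of_slot (hbSlot_eq_zero_of_large hx0 ρ κ hij hK hU)]
      exact (hxpos _).le
    -- `1 ≤ #T ≤ 3`
    have hT3 : T.card ≤ 3 := (card_le_of_zeta_slots hζ).trans (by omega)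
    have hT1 : 1 ≤ T.card := by
      by_contra h0
      have hTe : T = ∅ := Finset.card_eq_zero.1 (by omega)
      have hall : Tᶜ = Finset.univ := by rw [hTe, Finset.compl_empty]
      have h1 : ∏ i, V i ≤ x ^ (1 / 50 : ℝ) := by rw [← hall]; exact hTsm
      have h2 : x ^ (1 / 50 : ℝ) ≤ x ^ (1 - ρ₀) := Real.rpow_le_rpow_of_exponent_le hx1.le (by linarith)
      linarith
    exact hxI x hxI' w Y R Slo P hP hY0 hY hR hPR hSlo0 hSRP j hjmem κ T hT1 hT3 hζ hTbig hTsm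

/-- Landing anchor of the `𝔲_R`-bound chain, file 10; registered stub `urbChain10_anchor` of the crux item (the
mathematical content of this file is `urb_box`). -/
theorem urbChain10_anchor : True := trivial

end Summit.Parity.GeneralizedHardyLittlewood.Cruxes.TypeI2Dilated.PeelToDrappeau

end
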